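import Summits.QuantumAdvantage.AdviceFreeQNC0.Pinned39D
import HarnessLib

/-!
# Tree port (qn-prover-3 g24), PART 3 of planner qa-qnc0-p1 g39's custody file `qa-qnc0-p1/exp39/R1OneFar39.lean` (sha c3fe37051f5eddf9), verbatim —
# the generic r = 0 chain with a prescribed sign (WG/fG, pointwise_eqG, core_boundG, main_boundG) and twistBoundZNearPinned.  Previous part: `Pinned39D.lean`; see PART 1 (`SparseRead39C.lean`) and the custody module docstring there for the mathematics
# ((R1) at `C = 0`: near reads proved, far reads isolated; ROUND-38 §6.4.4 / P1-39c).
-/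

noncomputable section

namespace Summit.QuantumAdvantage.AdviceFreeQNC0

open Finset Literature.Computability.QuantumComplexity Literature.Computability.MetaComplexity

namespace BondTwist3

section NearOutputs

open Literature.Computability.MetaComplexity Literature.Computability.QuantumComplexity.RingHLF
open TransferWalk ConstBells TwistedTransfer

variable {n : ℕ}

/-! ### The generic r = 0 chain with a prescribed per-letter sign `e` -/

/-- Generic site weights: pin factor × sign × letter phase. -/
def WG (γ : Fin (n + 1) → ZMod 3) (e : ℕ → RegState 0 → Bool → Bool) (pn ξ : ℕ → Bool)
    (m : ℕ) (σ : RegState 0) (x : Bool) : ℂ :=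
  pinF pn ξ m x * (chi (e m σ x) * (if x then phase γ m else 1))

/-- Generic final vector (letter `n` = final spin) times the resolved event `[st = τ]`. -/
def fG (γ : Fin (n + 1) → ZMod 3) (τ : ZMod 3) (e : ℕ → RegState 0 → Bool → Bool) (pn ξ : ℕ → Bool)
    (σ : RegState 0) : ℂ :=
  pinF pn ξ n σ.2.1 * (chi (e n σ σ.2.1) * (if σ.2.1 then phase γ n else 1)) * (if -σ.1 = τ then 1 else 0)

/-- auxiliary lemma `norm_WG_le` (planner p1 g39, exp39; ported verbatim). -/
theorem norm_WG_le (γ : Fin (n + 1) → ZMod 3) (e : ℕ → RegState 0 → Bool → Bool) (pn ξ : ℕ → Bool)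
    (m : ℕ) (σ : RegState 0) (x : Bool) : ‖WG γ e pn ξ m σ x‖ ≤ 1 := by
  unfold WG
  rw [norm_mul, norm_mul, norm_chi]
  have h2 : ‖(if x then phase γ m else 1 : ℂ)‖ ≤ 1 := by
    split_ifs
    · exact norm_phase_le_one γ m
    · simp
  exact mul_le_one₀ (norm_pinF_le pn ξ m x) (by positivity) (by rw [one_mul]; exact h2)

/-- auxiliary lemma `norm_fG_le` (planner p1 g39, exp39; ported verbatim). -/
theorem norm_fG_le (γ : Fin (n + 1) → ZMod 3) (τ : ZMod 3) (e : ℕ → RegState 0 → Bool → Bool) (pn ξ : ℕ → Bool)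
    (σ : RegState 0) : ‖fG γ τ e pn ξ σ‖ ≤ 1 := by
  unfold fG
  rw [norm_mul, norm_mul, norm_mul, norm_chi]
  have h2 : ‖(if σ.2.1 then phase γ n else 1 : ℂ)‖ ≤ 1 := by
    split_ifs
    · exact norm_phase_le_one γ n
    · simp
  have h3 : ‖(if -σ.1 = τ then (1 : ℂ) else 0)‖ ≤ 1 := by split_ifs <;> simp
  exact mul_le_one₀ (mul_le_one₀ (norm_pinF_le pn ξ n _) (by positivity) (by rw [one_mul]; exact h2))
    (norm_nonneg _) h3

/-- auxiliary lemma `WG_eq_pinW` (planner p1 g39, exp39; ported verbatim). -/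
theorem WG_eq_pinW (γ : Fin (n + 1) → ZMod 3) (e : ℕ → RegState 0 → Bool → Bool) (pn ξ : ℕ → Bool)
    {m : ℕ} (hm : pn m = true) :
    WG γ e pn ξ m = pinW (ξ m) (fun σ x => chi (e m σ x) * (if x then phase γ m else 1)) := by
  funext σ x
  unfold WG pinW pinF
  rw [if_pos hm]
  by_cases hx : x = ξ m
  · rw [if_pos hx, if_pos hx, one_mul]
  · rw [if_neg hx, if_neg hx, zero_mul]

/-- auxiliary lemma `WG_eq_signW` (planner p1 g39, exp39; ported verbatim). -/
theorem WG_eq_signW (γ : Fin (n + 1) → ZMod 3) (e : ℕ → RegState 0 → Bool → Bool) (pn ξ : ℕ → Bool)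
    {m : ℕ} (hm : ¬ pn m = true) :
    WG γ e pn ξ m = signW (phase γ m) (fun σ x => e m σ x) := by
  funext σ x
  unfold WG signW pinF chi
  rw [if_neg hm, one_mul]

/-- **Generic pointwise identity**: given the sign identity on `st u n = τ`, the pinned twisted signed summand in walk coordinates
is the path weight of the generic chain. -/
theorem pointwise_eqG (γ : Fin (n + 1) → ZMod 3) (y : Fin (n + 1) → (Fin n → Bool) → Bool)
    (e : ℕ → RegState 0 → Bool → Bool) (κ τ : ZMod 3) (pn ξ : ℕ → Bool) (u : Fin n → Bool)
    (hsign : st u n = τ → (∏ g : Fin (n + 1), sgnF (y g u) κ (st u g.val) τ) =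
      ∏ m ∈ range (n + 1), chi (e m (stU 0 u m) (xs u m))) :
    (∏ m ∈ range (n + 1), pinF pn ξ m (xs u m)) *
      ((ZMod.stdAddChar (∑ i : Fin (n + 1), if xOfU u i then γ i else 0) : ℂ) *
        ((if st u n = τ then (1 : ℂ) else 0) * ∏ g : Fin (n + 1), sgnF (y g u) κ (st u g.val) τ)) =
      pathW (WG γ e pn ξ) (fG γ τ e pn ξ) 0 (initState 0) n (xs u) := by
  classical
  unfold pathW
  rw [traj_xs u n le_rfl]
  have hfin : fG γ τ e pn ξ (stU 0 u n) =
      pinF pn ξ n (xs u n) * (chi (e n (stU 0 u n) (xs u n)) * (if xs u n then phase γ n else 1)) *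
        (if st u n = τ then 1 else 0) := by
    unfold fG
    have e2 : (stU 0 u n).2.1 = xs u n := by rw [xs_last]; rfl
    have e1 : -(stU 0 u n).1 = st u n := by unfold stU; simp
    rw [e2, e1]
  have htraj : ∀ m ∈ range n, WG γ e pn ξ (0 + m) (traj (xs u) (initState 0) m) (xs u m) =
      pinF pn ξ m (xs u m) * (chi (e m (stU 0 u m) (xs u m)) * (if xs u m then phase γ m else 1)) := by
    intro m hm
    rw [mem_range] at hm
    rw [zero_add, traj_xs u m hm.le]
    rfl
  rw [prod_congr rfl htraj, prod_mul_distrib, prod_mul_distrib, hfin]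
  by_cases hτ : st u n = τ
  · rw [if_pos hτ, hsign hτ]
    have hphase : (∏ m ∈ range n, (if xs u m then phase γ m else 1 : ℂ)) * (if xs u n then phase γ n else 1) =
        (ZMod.stdAddChar (∑ i : Fin (n + 1), if xOfU u i then γ i else 0) : ℂ) := by
      rw [char_eq_prod, ← Finset.prod_range_succ (fun m => (if xs u m then phase γ m else 1 : ℂ)) n,
        ← Fin.prod_univ_eq_prod_range (fun m => (if xs u m then phase γ m else 1 : ℂ)) (n + 1)]
      refine prod_congr rfl fun i _ => ?_
      rw [xs_fin u i]
    rw [← hphase, prod_range_succ (fun m => pinF pn ξ m (xs u m)) n,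
      prod_range_succ (fun m => chi (e m (stU 0 u m) (xs u m))) n]
    ring
  · rw [if_neg hτ]
    simp

/-- **Generic core bound**. -/
theorem core_boundG {ρ : ℝ} (hρ0 : 0 ≤ ρ) (hρ : SiteContracts ρ) (γ : Fin (n + 1) → ZMod 3)
    (y : Fin (n + 1) → (Fin n → Bool) → Bool) (e : ℕ → RegState 0 → Bool → Bool) (κ τ : ZMod 3) (pn ξ : ℕ → Bool)
    (hsign : ∀ u : Fin n → Bool, st u n = τ → (∏ g : Fin (n + 1), sgnF (y g u) κ (st u g.val) τ) =
      ∏ m ∈ range (n + 1), chi (e m (stU 0 u m) (xs u m))) :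
    ‖∑ u : Fin n → Bool, (∏ m ∈ range (n + 1), pinF pn ξ m (xs u m)) *
        ((ZMod.stdAddChar (∑ i : Fin (n + 1), if xOfU u i then γ i else 0) : ℂ) *
          ((if st u n = τ then (1 : ℂ) else 0) * ∏ g : Fin (n + 1), sgnF (y g u) κ (st u g.val) τ))‖ ≤
      Real.sqrt 6 * ρ ^ (siteCnt (fun j => gammaN γ j ≠ 0 ∧ ¬ pn j = true) 0 n) * (2 : ℝ) ^ n /
        (2 : ℝ) ^ (siteCnt (fun j => pn j = true) 0 n) := by
  have hsum : ∑ u : Fin n → Bool, (∏ m ∈ range (n + 1), pinF pn ξ m (xs u m)) *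
        ((ZMod.stdAddChar (∑ i : Fin (n + 1), if xOfU u i then γ i else 0) : ℂ) *
          ((if st u n = τ then (1 : ℂ) else 0) * ∏ g : Fin (n + 1), sgnF (y g u) κ (st u g.val) τ)) =
      ∑ bb : Fin n → Bool, pathW (WG γ e pn ξ) (fG γ τ e pn ξ) 0 (initState 0) n (extB bb) := by
    rw [Finset.sum_congr rfl fun u _ => pointwise_eqG γ y e κ τ pn ξ u (hsign u)]
    have e1 : ∀ u : Fin n → Bool, pathW (WG γ e pn ξ) (fG γ τ e pn ξ) 0 (initState 0) n (xs u) =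
        pathW (WG γ e pn ξ) (fG γ τ e pn ξ) 0 (initState 0) n (extB (letters u)) :=
      fun u => pathW_congr _ _ 0 (initState 0) n fun m hm => (extB_letters u hm).symm
    rw [Finset.sum_congr rfl fun u _ => e1 u,
      sum_letters (fun bb => pathW (WG γ e pn ξ) (fG γ τ e pn ξ) 0 (initState 0) n (extB bb))]
  rw [hsum]
  refine norm_sum_pathW_mixed_le hρ0 hρ (WG γ e pn ξ) (norm_WG_le γ e pn ξ) (fun j => pn j = true)
    (fun j => gammaN γ j ≠ 0) (fun j hj => ⟨ξ j, _, fun σ x => ?_, WG_eq_pinW γ e pn ξ hj⟩)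
    (fun j hj hnp => ⟨phase γ j, _, phase_cube γ j, phase_ne_one_of_gammaN γ hj, WG_eq_signW γ e pn ξ hnp⟩)
    (fG γ τ e pn ξ) (norm_fG_le γ τ e pn ξ) (initState 0) n 0
  rw [norm_mul, norm_chi, one_mul]
  split_ifs
  · exact norm_phase_le_one γ j
  · simp

/-- The unsigned resolution for a general bell family. -/
theorem sum_resolve_offG (κ : ZMod 3) (y : Fin (n + 1) → (Fin n → Bool) → Bool) (u : Fin n → Bool) :
    ∑ τ : ZMod 3, (if st u n = τ then (1 : ℂ) else 0) *
        ∏ g : Fin (n + 1), sgnF (false && y g u) κ (st u g.val) τ = 1 := by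
  have h1 : ∀ τ : ZMod 3, (∏ g : Fin (n + 1), sgnF (false && y g u) κ (st u g.val) τ) = 1 :=
    fun τ => prod_eq_one fun g _ => by unfold sgnF; simp
  simp_rw [h1, mul_one]
  rw [Finset.sum_ite_eq univ (st u n) (fun _ => (1 : ℂ)), if_pos (mem_univ _)]

open scoped Classical in
/-- **Generic main bound** for a strategy map `z` whose walk-frame win sign re-associates to a per-letter sign `e`. -/
theorem main_boundG {ρ : ℝ} (hρ0 : 0 ≤ ρ) (hρ : SiteContracts ρ) (hn2 : 2 ≤ n) (γ : Fin (n + 1) → ZMod 3)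
    (z : (Fin (n + 1) → Bool) → Fin (n + 1) → Bool)
    (e : ZMod 3 → ZMod 3 → Bool → ℕ → RegState 0 → Bool → Bool)
    (hsign : ∀ (κ τ : ZMod 3) (on : Bool) (u : Fin n → Bool), st u n = τ →
      (∏ g : Fin (n + 1), sgnF (on && xor (z (xOfU u) g) (tGuess (xOfU u) g)) κ (st u g.val) τ) =
        ∏ m ∈ range (n + 1), chi (e κ τ on m (stU 0 u m) (xs u m)))
    (pn ξ : ℕ → Bool) :
    ‖∑ x : Fin (n + 1) → Bool, (∏ i : Fin (n + 1), pinF pn ξ i.val (x i)) *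
        ((ZMod.stdAddChar (∑ i : Fin (n + 1), if x i then γ i else 0) : ℂ) *
          (if (OddZeros x ∧ RingHLF.Rel x (z x)) then (1 : ℂ) else 0))‖ ≤
      3 * (Real.sqrt 6 * ρ ^ (siteCnt (fun j => gammaN γ j ≠ 0 ∧ ¬ pn j = true) 0 n) * (2 : ℝ) ^ n /
        (2 : ℝ) ^ (siteCnt (fun j => pn j = true) 0 n)) := by
  classical
  set M : ℝ := Real.sqrt 6 * ρ ^ (siteCnt (fun j => gammaN γ j ≠ 0 ∧ ¬ pn j = true) 0 n) * (2 : ℝ) ^ n /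
    (2 : ℝ) ^ (siteCnt (fun j => pn j = true) 0 n) with hM
  set Y : Fin (n + 1) → (Fin n → Bool) → Bool := fun g u => xor (z (xOfU u) g) (tGuess (xOfU u) g) with hY
  set Pu : (Fin n → Bool) → ℂ := fun u => ∏ m ∈ range (n + 1), pinF pn ξ m (xs u m) with hPu
  have hPx : ∀ u : Fin n → Bool, (∏ i : Fin (n + 1), pinF pn ξ i.val (xOfU u i)) = Pu u := by
    intro u
    simp only [hPu]
    rw [← Fin.prod_univ_eq_prod_range (fun m => pinF pn ξ m (xs u m)) (n + 1)]
    exact prod_congr rfl fun i _ => by rw [xs_fin u i]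
  set F : (Fin (n + 1) → Bool) → ℂ := fun x => (∏ i : Fin (n + 1), pinF pn ξ i.val (x i)) *
    ((ZMod.stdAddChar (∑ i : Fin (n + 1), if x i then γ i else 0) : ℂ) *
      (if (OddZeros x ∧ RingHLF.Rel x (z x)) then (1 : ℂ) else 0)) with hF
  set E : (Fin n → Bool) → ℂ := fun u => (ZMod.stdAddChar (∑ i : Fin (n + 1), if xOfU u i then γ i else 0) : ℂ) with hE
  set G : (Fin n → Bool) → ℂ := fun u => Pu u * (E u * (if ringWinU (n + 2) Y u = true then (1 : ℂ) else 0))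
    with hG
  have hodd : ∑ x : Fin (n + 1) → Bool, F x =
      ∑ x ∈ (univ.filter fun x : Fin (n + 1) → Bool => (univ.filter fun j : Fin (n + 1) => x j = false).card % 2 = 1),
        G (uVec x) := by
    rw [← Finset.sum_filter_add_sum_filter_not univ
      (fun x : Fin (n + 1) → Bool => (univ.filter fun j : Fin (n + 1) => x j = false).card % 2 = 1) F]
    have hzero : ∑ x ∈ univ.filter (fun x : Fin (n + 1) → Bool =>
        ¬ (univ.filter fun j : Fin (n + 1) => x j = false).card % 2 = 1), F x = 0 := by
      refine Finset.sum_eq_zero fun x hx => ?_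
      rw [mem_filter] at hx
      have : ¬ (OddZeros x ∧ RingHLF.Rel x (z x)) := fun h => hx.2 h.1
      simp only [hF, this, if_false, mul_zero]
    rw [hzero, add_zero]
    refine Finset.sum_congr rfl fun x hx => ?_
    rw [mem_filter] at hx
    have hxo : OddZeros x := hx.2
    have hrel : RingHLF.Rel x (z x) ↔ ringWinU (n + 2) Y (uVec x) = true :=
      rel_iff_ringWinU hn2 x hx.2 z
    have hP : (∏ i : Fin (n + 1), pinF pn ξ i.val (x i)) = Pu (uVec x) := by
      rw [← hPx (uVec x)]
      exact prod_congr rfl fun i _ => by rw [xOfU_uVec hn2 x hx.2]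
    simp only [hF, hG, hE, xOfU_uVec hn2 x hx.2]
    rw [hP]
    by_cases hr : RingHLF.Rel x (z x)
    · rw [if_pos ⟨hxo, hr⟩, if_pos (hrel.1 hr)]
    · rw [if_neg (fun h => hr h.2), if_neg (fun h => hr (hrel.2 h))]
  rw [hodd, sum_odd_eq_sum_u hn2 G]
  set κ : ZMod 3 := ((n + 2 + 2 * n : ℕ) : ZMod 3) with hκ
  set C : Bool → ZMod 3 → ℂ := fun on τ => ∑ u : Fin n → Bool, Pu u * (E u *
    ((if st u n = τ then (1 : ℂ) else 0) * ∏ g : Fin (n + 1), sgnF (on && Y g u) κ (st u g.val) τ)) with hC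
  have hGsplit : ∀ u : Fin n → Bool, G u =
      (Pu u * (E u * ∑ τ : ZMod 3, (if st u n = τ then (1 : ℂ) else 0) *
          ∏ g : Fin (n + 1), sgnF (false && Y g u) κ (st u g.val) τ) -
       Pu u * (E u * ∑ τ : ZMod 3, (if st u n = τ then (1 : ℂ) else 0) *
          ∏ g : Fin (n + 1), sgnF (true && Y g u) κ (st u g.val) τ)) / 2 := by
    intro u
    have hsg2 := winSign_eq_sum (n + 2) Y u
    have hsg : ∀ (τ : ZMod 3) (g : Fin (n + 1)),
        (if (Y g u = true ∧ ((n + 2 + 2 * n : ℕ) : ZMod 3) + st u g.val + τ ≠ 0) then (-1 : ℂ) else 1) =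
          sgnF (true && Y g u) κ (st u g.val) τ := fun τ g => rfl
    simp only [hsg] at hsg2
    rw [sum_resolve_offG κ Y u, ← hsg2]
    simp only [hG]
    split_ifs <;> ring
  have hGsum : ∑ u : Fin n → Bool, G u = ((∑ τ : ZMod 3, C false τ) - ∑ τ : ZMod 3, C true τ) / 2 := by
    simp_rw [hGsplit]
    rw [← Finset.sum_div, Finset.sum_sub_distrib]
    congr 2
    · simp only [hC]; rw [Finset.sum_comm]
      exact sum_congr rfl fun u _ => by rw [Finset.mul_sum, Finset.mul_sum]
    · simp only [hC]; rw [Finset.sum_comm]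
      exact sum_congr rfl fun u _ => by rw [Finset.mul_sum, Finset.mul_sum]
  rw [hGsum, norm_div, Complex.norm_two]
  have hB : ∀ on τ, ‖C on τ‖ ≤ M := fun on τ =>
    core_boundG hρ0 hρ γ (fun g u => on && Y g u) (e κ τ on) κ τ pn ξ (fun u hu => hsign κ τ on u hu)
  have h3 : ∀ on, ‖∑ τ : ZMod 3, C on τ‖ ≤ 3 * M := by
    intro on
    calc ‖∑ τ : ZMod 3, C on τ‖ ≤ ∑ τ : ZMod 3, ‖C on τ‖ := norm_sum_le _ _
      _ ≤ ∑ _τ : ZMod 3, M := sum_le_sum fun τ _ => hB on τ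
      _ = 3 * M := by rw [sum_const, card_univ, ZMod.card]; simp
  have htri := norm_sub_le (∑ τ : ZMod 3, C false τ) (∑ τ : ZMod 3, C true τ)
  have hM0 : 0 ≤ M := by rw [hM]; positivity
  have := h3 false; have := h3 true
  linarith

/-- The sign hypothesis of `main_boundG` for near-read affine outputs. -/
theorem hsign_aff {i : Fin (n + 1) → Fin (n + 1)} (hnear : NearN i) (b c : Fin (n + 1) → Bool)
    (κ τ : ZMod 3) (on : Bool) (u : Fin n → Bool) (hτ : st u n = τ) :
    (∏ g : Fin (n + 1), sgnF (on && xor ((fun x k => xor (b k) (c k && x (i k))) (xOfU u) g) (tGuess (xOfU u) g))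
        κ (st u g.val) τ) =
      ∏ m ∈ range (n + 1), chi (on && epsA (bN b) (rSN c i) (rNN c i) (rPN c i) κ τ n m (stU 0 u m) (xs u m)) := by
  cases on
  · simp only [Bool.false_and, chi_false, prod_const_one]
    exact prod_eq_one fun g _ => by unfold sgnF; simp
  · simp only [Bool.true_and]
    exact sign_reassocA hnear b c κ τ u hτ

open scoped Classical in
/-- The trivial bound for a general output map: norm `≤ 2^N`. -/
theorem trivial_boundG (N : ℕ) (P : Finset (Fin N)) (ξ : Fin N → Bool) (out : (Fin N → Bool) → Fin N → Bool)
    (β : Fin N → ZMod 3) :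
    ‖∑ x : Fin N → Bool, (if (∀ i ∈ P, x i = ξ i) then (1 : ℂ) else 0) *
        ((ZMod.stdAddChar (∑ i : Fin N, if x i then β i else 0) : ℂ) *
          (if (OddZeros x ∧ RingHLF.Rel x (out x)) then (1 : ℂ) else 0))‖ ≤ (2 : ℝ) ^ N := by
  classical
  refine (norm_sum_le _ _).trans ?_
  have hterm : ∀ x : Fin N → Bool, ‖(if (∀ i ∈ P, x i = ξ i) then (1 : ℂ) else 0) *
        ((ZMod.stdAddChar (∑ i : Fin N, if x i then β i else 0) : ℂ) *
          (if (OddZeros x ∧ RingHLF.Rel x (out x)) then (1 : ℂ) else 0))‖ ≤ 1 := by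
    intro x
    rw [norm_mul, norm_mul]
    have h0 : ‖(if (∀ i ∈ P, x i = ξ i) then (1 : ℂ) else 0)‖ ≤ 1 := by split_ifs <;> simp
    have h1 : ‖(ZMod.stdAddChar (∑ i : Fin N, if x i then β i else 0) : ℂ)‖ ≤ 1 := by
      have h3 := stdAddChar_cube (∑ i : Fin N, if x i then β i else 0)
      have hn : ‖(ZMod.stdAddChar (∑ i : Fin N, if x i then β i else 0) : ℂ)‖ ^ 3 = 1 := by
        rw [← norm_pow, h3, norm_one]
      exact ((pow_eq_one_iff_of_nonneg (norm_nonneg _) (by norm_num)).1 hn).le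
    have h2 : ‖(if (OddZeros x ∧ RingHLF.Rel x (out x)) then (1 : ℂ) else 0)‖ ≤ 1 := by
      split_ifs <;> simp
    exact mul_le_one₀ h0 (by positivity) (mul_le_one₀ h1 (norm_nonneg _) h2)
  refine (sum_le_sum fun x _ => hterm x).trans ?_
  rw [sum_const, card_univ, Fintype.card_fun, Fintype.card_bool, Fintype.card_fin]
  simp

open scoped Classical in
/-- **`TwistBoundZNearPinned ρ`** — restated verbatim from `exp39/SparseRead39.lean` v5: affine outputs `b_k ⊕ c_k·x_{i k}` with a
NEAR reader map, on pinned subcubes, decay like `ρ^{#free twisted letters}` (read or not), normalised by `2^{N − |P|}`. -/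
def TwistBoundZNearPinned (ρ : ℝ) : Prop :=
  ∃ A : ℝ, ∀ (N : ℕ) (P : Finset (Fin N)) (ξ b c : Fin N → Bool) (i : Fin N → Fin N),
    (∀ k, (i k).val = k.val ∨ (i k).val = (k.val + 1) % N ∨ k.val = ((i k).val + 1) % N) →
    ∀ (β : Fin N → ZMod 3),
      ‖∑ x : Fin N → Bool, (if (∀ i ∈ P, x i = ξ i) then (1 : ℂ) else 0) *
          ((ZMod.stdAddChar (∑ i : Fin N, if x i then β i else 0) : ℂ) *
            (if (OddZeros x ∧ RingHLF.Rel x (fun k => xor (b k) (c k && x (i k)))) then (1 : ℂ) else 0))‖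
        ≤ A * ρ ^ (univ.filter fun j : Fin N => j ∉ P ∧ β j ≠ 0).card * (2 : ℝ) ^ (N - P.card)

/-- **THEOREM (A39-8): `TwistBoundZNearPinned ρ` holds for some `ρ < 1`** — hence `R1OneFar ρ` by
`SparseRead39.r1OneFar_of_nearPinned`: (R1) at `C = 0` up to the far-read twisted letters. -/
theorem twistBoundZNearPinned : ∃ ρ : ℝ, 0 ≤ ρ ∧ ρ < 1 ∧ TwistBoundZNearPinned ρ := by
  classical
  obtain ⟨ρ₀, hρ0, hρ1, hS⟩ := siteContracts_exists
  set ρ : ℝ := max ρ₀ (1 / 2) with hρdef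
  have hρpos : 0 < ρ := lt_of_lt_of_le (by norm_num) (le_max_right _ _)
  have hρlt : ρ < 1 := max_lt hρ1 (by norm_num)
  have hρle1 : ρ ≤ 1 := hρlt.le
  have hSρ : SiteContracts ρ := siteContracts_mono hS (pow_le_pow_left₀ hρ0 (le_max_left _ _) 2)
  refine ⟨ρ, hρpos.le, hρlt, 3 * Real.sqrt 6 / ρ + 4 / ρ ^ 2, fun N P ξ b c i hnear β => ?_⟩
  set w := (univ.filter fun j : Fin N => j ∉ P ∧ β j ≠ 0).card with hw
  have hwN : w ≤ N := (card_filter_le _ _).trans (by simp)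
  have hPN : P.card ≤ N := (card_le_univ P).trans (by simp)
  have hA1 : 0 ≤ 3 * Real.sqrt 6 / ρ := by positivity
  have hA2 : 0 ≤ 4 / ρ ^ 2 := by positivity
  have hρw : 0 ≤ ρ ^ w := by positivity
  have h2NP : (1 : ℝ) ≤ (2 : ℝ) ^ (N - P.card) := one_le_pow₀ (by norm_num)
  rcases Nat.lt_or_ge N 3 with hN | hN
  · have htriv := trivial_boundG N P ξ (fun x k => xor (b k) (c k && x (i k))) β
    have h2N : (2 : ℝ) ^ N ≤ 4 := by
      calc (2 : ℝ) ^ N ≤ 2 ^ 2 := pow_le_pow_right₀ (by norm_num) (by omega)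
        _ = 4 := by norm_num
    have hρw2 : ρ ^ 2 ≤ ρ ^ w := pow_le_pow_of_le_one hρpos.le hρle1 (by omega)
    have hkey : (4 : ℝ) ≤ (4 / ρ ^ 2) * ρ ^ w * (2 : ℝ) ^ (N - P.card) := by
      have hρ2 : ρ ^ 2 ≠ 0 := by positivity
      have h4 : (4 : ℝ) ≤ 4 / ρ ^ 2 * ρ ^ w :=
        calc (4 : ℝ) = 4 / ρ ^ 2 * ρ ^ 2 := by field_simp
          _ ≤ 4 / ρ ^ 2 * ρ ^ w := mul_le_mul_of_nonneg_left hρw2 hA2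
      nlinarith
    calc _ ≤ (2 : ℝ) ^ N := htriv
      _ ≤ 4 := h2N
      _ ≤ (4 / ρ ^ 2) * ρ ^ w * (2 : ℝ) ^ (N - P.card) := hkey
      _ ≤ (3 * Real.sqrt 6 / ρ + 4 / ρ ^ 2) * ρ ^ w * (2 : ℝ) ^ (N - P.card) := by
          gcongr; linarith
  · obtain ⟨n, rfl⟩ : ∃ n, N = n + 1 := ⟨N - 1, by omega⟩
    have hn2 : 2 ≤ n := by omega
    have hnear' : NearN i := hnear
    have hmain := main_boundG hρpos.le hSρ hn2 β (fun x k => xor (b k) (c k && x (i k)))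
      (fun κ τ on m σ x => on && epsA (bN b) (rSN c i) (rNN c i) (rPN c i) κ τ n m σ x)
      (fun κ τ on u hu => hsign_aff hnear' b c κ τ on u hu) (pnOf P) (ξN ξ)
    simp_rw [pin_prod_eq P ξ] at hmain
    set t := siteCnt (fun j => gammaN β j ≠ 0 ∧ ¬ pnOf P j = true) 0 n with ht
    set p := siteCnt (fun j => pnOf P j = true) 0 n with hp
    have htw : w ≤ t + 1 := by rw [hw, ht]; exact card_free_twisted_le P β
    have hpP : P.card ≤ p + 1 := by rw [hp]; exact card_pinned_le P
    have hrate : ρ ^ t ≤ ρ ^ w / ρ := by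
      rw [le_div_iff₀ hρpos, ← pow_succ]
      exact pow_le_pow_of_le_one hρpos.le hρle1 htw
    have hcube : (2 : ℝ) ^ n / (2 : ℝ) ^ p ≤ (2 : ℝ) ^ (n + 1 - P.card) := by
      rw [div_le_iff₀ (by positivity), ← pow_add]
      exact pow_le_pow_right₀ (by norm_num) (by omega)
    have hfin : 3 * (Real.sqrt 6 * ρ ^ t * (2 : ℝ) ^ n / (2 : ℝ) ^ p) ≤
        (3 * Real.sqrt 6 / ρ) * ρ ^ w * (2 : ℝ) ^ (n + 1 - P.card) := by
      have e : 3 * (Real.sqrt 6 * ρ ^ t * (2 : ℝ) ^ n / (2 : ℝ) ^ p) =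
          3 * Real.sqrt 6 * ρ ^ t * ((2 : ℝ) ^ n / (2 : ℝ) ^ p) := by ring
      have e2 : (3 * Real.sqrt 6 / ρ) * ρ ^ w * (2 : ℝ) ^ (n + 1 - P.card) =
          3 * Real.sqrt 6 * (ρ ^ w / ρ) * (2 : ℝ) ^ (n + 1 - P.card) := by ring
      rw [e, e2]
      have h6 : 0 ≤ 3 * Real.sqrt 6 := by positivity
      have hq : 0 ≤ (2 : ℝ) ^ n / (2 : ℝ) ^ p := by positivity
      calc 3 * Real.sqrt 6 * ρ ^ t * ((2 : ℝ) ^ n / (2 : ℝ) ^ p)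
          ≤ 3 * Real.sqrt 6 * (ρ ^ w / ρ) * ((2 : ℝ) ^ n / (2 : ℝ) ^ p) := by gcongr
        _ ≤ 3 * Real.sqrt 6 * (ρ ^ w / ρ) * (2 : ℝ) ^ (n + 1 - P.card) := by
            have : 0 ≤ 3 * Real.sqrt 6 * (ρ ^ w / ρ) := by positivity
            exact mul_le_mul_of_nonneg_left hcube this
    calc _ ≤ 3 * (Real.sqrt 6 * ρ ^ t * (2 : ℝ) ^ n / (2 : ℝ) ^ p) := hmain
      _ ≤ (3 * Real.sqrt 6 / ρ) * ρ ^ w * (2 : ℝ) ^ (n + 1 - P.card) := hfin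
      _ ≤ (3 * Real.sqrt 6 / ρ + 4 / ρ ^ 2) * ρ ^ w * (2 : ℝ) ^ (n + 1 - P.card) := by
          gcongr; linarith


end NearOutputs

end BondTwist3

end Summit.QuantumAdvantage.AdviceFreeQNC0
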